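import Summits.QuantumAdvantage.QuantumAdvantage.Theorems.CubicForrelationNearExactIsExactCubicFormPartnerTransport
import Summits.QuantumAdvantage.QuantumAdvantage.Theorems.CubicForrelationNearExactIsExactCubicFormR2PartnerTools
import Summits.QuantumAdvantage.QuantumAdvantage.Theorems.CubicForrelationNearExactIsExactCubicFormCells
import Mathlib.Algebra.BigOperators.Fin

/-!
# Crux `CubicForrelation.NearExactIsExact` (stmt-QuantumAdvantage-14043) — E1280-even, R2 branch: the `S₃`-SYMMETRY of the adapted frame
  (WLOG the light cell is `C₀₀`)

Certificate seat `b2b-cforr-cert` (gen 42).  HONEST FRAMING: kernel-checked bookkeeping (standard axioms).  R2-PARTNER.md §2 "SYMMETRY":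
the affine maps `(y₁,y₂) ↦ (y₁ ⊕ y₂ ⊕ 1, y₂)` and `(y₁,y₂) ↦ (y₁, y₁ ⊕ y₂ ⊕ 1)` fix `e₀` and the frame identity `κ(y) ⊕ κ(y ⊕ e₀) = y₁y₂` and
permute the three free cells `C₀₀, C₁₀, C₀₁`; transporting the partner package along them (`tpw_partner_transport`) makes the light cell
`C₀₀` without loss.  Consumed by the level files `HL h` / `HEXC` of …CubicFormR2PartnerCells / …R2PartnerHyperplane.  Nothing about `θ₁₂`;
NOT summit progress.

* `tpw_yblock_frame`: block frames `M ⊕ 1ₘ` on `3 + m` bits (companion of `tbf_block_frame` = `1₃ ⊕ P`).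
* `tpw_R2_yframe_transport`: the package transported along `y ↦ b ⊕ (M ⊕ 1) y` when the induced cell map `α` respects the frame identity.
* `tpw_R2_wlog_base`: for a free cell `(i,j)` there is an equivalent package whose cell `C₀₀` is the old `C_{ij}`, whose `C_{ij}` is the old
  `C₀₀`, and whose third free cell is unchanged.

References: this seat lineage (g37 R2-PARTNER §2).  Axioms: the standard three.
-/

set_option linter.dupNamespace false -- D-0017: single-problem summit ⇒ `QuantumAdvantage.QuantumAdvantage` by design

namespace Summit.QuantumAdvantage.QuantumAdvantage.Theorems.CubicForrelation.NearExactIsExact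

open Finset
open Literature.Computability.QuantumComplexity
open Literature.Computability.QuantumComplexity.BuzetChailloux (bxor zeroVec bxor_comm bxor_self bxor_zeroVec zeroVec_bxor
  bxor_bxor_cancel_left)

variable {m : ℕ}

/-- Every vector on `3 + m` bits is an appended pair. [folklore] -/
theorem tpw_append_split (y : Fin (3 + m) → Bool) :
    y = Fin.append (fun t => y (Fin.castAdd m t)) (fun σ => y (Fin.natAdd 3 σ)) := by
  funext l
  refine Fin.addCases (fun t => ?_) (fun σ => ?_) l
  · rw [Fin.append_left]
  · rw [Fin.append_right]

/-- The unit vector `e₀` of `3 + m` bits as an appended pair. [folklore] -/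
theorem tpw_e0_append :
    (fun l : Fin (3 + m) => decide (l = Fin.castAdd m (0 : Fin 3))) = Fin.append ![true, false, false] (zeroVec : Fin m → Bool) := by
  funext l
  refine Fin.addCases (fun t => ?_) (fun σ => ?_) l
  · rw [Fin.append_left]
    fin_cases t
    · simp
    · simp [Fin.ext_iff]
    · simp [Fin.ext_iff]
  · rw [Fin.append_right]
    have hne : Fin.natAdd 3 σ ≠ Fin.castAdd m (0 : Fin 3) := fun h => by
      have := congrArg Fin.val h; simp only [Fin.val_natAdd, Fin.val_castAdd] at this; omega
    simp [hne, zeroVec]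

/-- **Block frames `M ⊕ 1ₘ`.**  For an inverse pair `M, Mi` on `Fin 3` there is an inverse pair `L, Li` on `Fin (3 + m)` acting by
`L·(Fin.append v s) = Fin.append (M·v) s`, `Li·(Fin.append v s) = Fin.append (Mi·v) s`. [folklore] -/
theorem tpw_yblock_frame (M Mi : Fin 3 → Fin 3 → ZMod 2)
    (hMMi : ∀ t t', (∑ u, M t u * Mi u t') = if t = t' then 1 else 0)
    (hMiM : ∀ t t', (∑ u, Mi t u * M u t') = if t = t' then 1 else 0) :
    ∃ L Li : Fin (3 + m) → Fin (3 + m) → ZMod 2,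
      (∀ ψ ω, (∑ φ, L ψ φ * Li φ ω) = if ψ = ω then 1 else 0) ∧
      (∀ ψ ω, (∑ φ, Li ψ φ * L φ ω) = if ψ = ω then 1 else 0) ∧
      (∀ (v : Fin 3 → Bool) (s : Fin m → Bool),
        (fun ψ => decide ((∑ φ, L ψ φ * (if Fin.append v s φ = true then (1 : ZMod 2) else 0)) = 1)) =
          Fin.append (fun t => decide ((∑ t', M t t' * (if v t' = true then (1 : ZMod 2) else 0)) = 1)) s) ∧
      (∀ (v : Fin 3 → Bool) (s : Fin m → Bool),
        (fun ψ => decide ((∑ φ, Li ψ φ * (if Fin.append v s φ = true then (1 : ZMod 2) else 0)) = 1)) =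
          Fin.append (fun t => decide ((∑ t', Mi t t' * (if v t' = true then (1 : ZMod 2) else 0)) = 1)) s) := by
  classical
  let blk : (Fin 3 → Fin 3 → ZMod 2) → Fin (3 + m) → Fin (3 + m) → ZMod 2 := fun N ψ φ =>
    Fin.addCases (fun t => Fin.addCases (fun t' => N t t') (fun _ => 0) φ)
      (fun σ => Fin.addCases (fun _ => (0 : ZMod 2)) (fun σ' => if σ = σ' then (1 : ZMod 2) else 0) φ) ψ
  have hb11 : ∀ N t t', blk N (Fin.castAdd m t) (Fin.castAdd m t') = N t t' := by
    intro N t t'; simp only [blk, Fin.addCases_left]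
  have hb12 : ∀ N t σ, blk N (Fin.castAdd m t) (Fin.natAdd 3 σ) = 0 := by
    intro N t σ; simp only [blk, Fin.addCases_left, Fin.addCases_right]
  have hb21 : ∀ N σ t, blk N (Fin.natAdd 3 σ) (Fin.castAdd m t) = 0 := by
    intro N σ t; simp only [blk, Fin.addCases_left, Fin.addCases_right]
  have hb22 : ∀ N σ σ', blk N (Fin.natAdd 3 σ) (Fin.natAdd 3 σ') = if σ = σ' then 1 else 0 := by
    intro N σ σ'; simp only [blk, Fin.addCases_right]
  have hmul : ∀ (N N' : Fin 3 → Fin 3 → ZMod 2) ψ ω, (∑ φ, blk N ψ φ * blk N' φ ω) =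
      Fin.addCases (fun t => Fin.addCases (fun t' => ∑ u, N t u * N' u t') (fun _ => 0) ω)
        (fun σ => Fin.addCases (fun _ => (0 : ZMod 2)) (fun σ' => if σ = σ' then (1 : ZMod 2) else 0) ω) ψ := by
    intro N N' ψ ω
    rw [Fin.sum_univ_add]
    refine Fin.addCases (fun t => ?_) (fun σ => ?_) ψ <;> refine Fin.addCases (fun t' => ?_) (fun σ' => ?_) ω
    · simp only [hb11, hb21, Fin.addCases_left, mul_zero, sum_const_zero, add_zero]
    · simp only [hb12, Fin.addCases_left, Fin.addCases_right, mul_zero, zero_mul, sum_const_zero, zero_add]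
    · simp only [hb21, Fin.addCases_left, Fin.addCases_right, zero_mul, mul_zero, sum_const_zero, zero_add]
    · simp only [hb21, hb22, Fin.addCases_right, zero_mul, sum_const_zero, zero_add]
      simp only [ite_mul, one_mul, zero_mul, sum_ite_eq, mem_univ, if_true]
  have hact : ∀ (N : Fin 3 → Fin 3 → ZMod 2) (v : Fin 3 → Bool) (s : Fin m → Bool),
      (fun ψ => decide ((∑ φ, blk N ψ φ * (if Fin.append v s φ = true then (1 : ZMod 2) else 0)) = 1)) =
        Fin.append (fun t => decide ((∑ t', N t t' * (if v t' = true then (1 : ZMod 2) else 0)) = 1)) s := by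
    intro N v s
    funext ψ
    rw [Fin.sum_univ_add]
    simp only [Fin.append_left, Fin.append_right]
    refine Fin.addCases (fun t => ?_) (fun σ => ?_) ψ
    · simp only [hb11, hb12, Fin.append_left, zero_mul, sum_const_zero, add_zero]
    · simp only [hb21, hb22, Fin.append_right, zero_mul, sum_const_zero, zero_add, ite_mul, one_mul, sum_ite_eq, mem_univ, if_true]
      cases s σ <;> decide
  refine ⟨blk M, blk Mi, fun ψ ω => ?_, fun ψ ω => ?_, hact M, hact Mi⟩
  · rw [hmul]
    refine Fin.addCases (fun t => ?_) (fun σ => ?_) ψ <;> refine Fin.addCases (fun t' => ?_) (fun σ' => ?_) ω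
    · simp only [Fin.addCases_left]
      rw [hMMi]
      by_cases h : t = t'
      · subst h; simp
      · rw [if_neg h, if_neg (fun e => h (Fin.castAdd_inj.mp e))]
    · simp only [Fin.addCases_left, Fin.addCases_right]
      rw [if_neg]; intro e; have := congrArg Fin.val e; simp at this; omega
    · simp only [Fin.addCases_left, Fin.addCases_right]
      rw [if_neg]; intro e; have := congrArg Fin.val e; simp at this; omega
    · simp only [Fin.addCases_right]
      by_cases h : σ = σ'
      · subst h; simp
      · rw [if_neg h, if_neg (fun e => h (Fin.natAdd_inj 3 |>.mp e))]
  · rw [hmul]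
    refine Fin.addCases (fun t => ?_) (fun σ => ?_) ψ <;> refine Fin.addCases (fun t' => ?_) (fun σ' => ?_) ω
    · simp only [Fin.addCases_left]
      rw [hMiM]
      by_cases h : t = t'
      · subst h; simp
      · rw [if_neg h, if_neg (fun e => h (Fin.castAdd_inj.mp e))]
    · simp only [Fin.addCases_left, Fin.addCases_right]
      rw [if_neg]; intro e; have := congrArg Fin.val e; simp at this; omega
    · simp only [Fin.addCases_left, Fin.addCases_right]
      rw [if_neg]; intro e; have := congrArg Fin.val e; simp at this; omega
    · simp only [Fin.addCases_right]
      by_cases h : σ = σ'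
      · subst h; simp
      · rw [if_neg h, if_neg (fun e => h (Fin.natAdd_inj 3 |>.mp e))]

/-- **Transport along a `y`-block frame.**  Let `M, Mi` be an inverse pair on `Fin 3`, `b₃ : 𝔽₂³` a translation, and
`α v := b₃ ⊕ M·v` the induced map of the `y`-block.  If `α` commutes with `⊕ e₀` and preserves `v₁ ∧ v₂`, then the partner package
transported along `y ↦ (b₃,0) ⊕ (M ⊕ 1) y` (`tpw_partner_transport`) is again an adapted-frame package (frame identity, `hF1`), and its cells
are `κ'(v, s) = κ(α v, s)`. [this work] -/
theorem tpw_R2_yframe_transport (κ : (Fin (3 + m) → Bool) → Bool) (hκ : IsDegLeFun 3 κ)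
    (c d : Fin (3 + m) → Fin (3 + m) → Fin (3 + m) → ZMod 2)
    (hcs : ∀ p j k, c p k j = c p j k) (hcc : ∀ p j k, c j p k = c p j k) (hcd : ∀ p j, c p j j = 0)
    (hds : ∀ φ j k, d φ k j = d φ j k) (hdd : ∀ φ j, d φ j j = 0)
    (hd : ∀ φ j k, d φ j k =
      if ((((κ zeroVec ^^ κ (bxor zeroVec (fun l => decide (l = k)))) ^^
            (κ (bxor zeroVec (fun l => decide (l = j))) ^^ κ (bxor (bxor zeroVec (fun l => decide (l = j))) (fun l => decide (l = k))))) ^^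
          ((κ (bxor zeroVec (fun l => decide (l = φ))) ^^ κ (bxor (bxor zeroVec (fun l => decide (l = φ))) (fun l => decide (l = k)))) ^^
            (κ (bxor (bxor zeroVec (fun l => decide (l = φ))) (fun l => decide (l = j))) ^^
              κ (bxor (bxor (bxor zeroVec (fun l => decide (l = φ))) (fun l => decide (l = j))) (fun l => decide (l = k))))))) = true
      then 1 else 0)
    (hpair : ∀ p φ, (∑ j, ∑ k, (if j < k then c p j k * d φ j k else 0)) = if p = φ then 1 else 0)
    (hD0 : ∀ y, (κ y ^^ κ (bxor y (fun l => decide (l = Fin.castAdd m (0 : Fin 3))))) =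
      (y (Fin.castAdd m (1 : Fin 3)) && y (Fin.castAdd m (2 : Fin 3))))
    (M Mi : Fin 3 → Fin 3 → ZMod 2)
    (hMMi : ∀ t t', (∑ u, M t u * Mi u t') = if t = t' then 1 else 0)
    (hMiM : ∀ t t', (∑ u, Mi t u * M u t') = if t = t' then 1 else 0) (b₃ : Fin 3 → Bool)
    (hα0 : ∀ v : Fin 3 → Bool, bxor b₃ (fun t => decide ((∑ t', M t t' * (if (bxor v ![true, false, false]) t' = true then (1 : ZMod 2) else 0)) = 1)) =
      bxor (bxor b₃ (fun t => decide ((∑ t', M t t' * (if v t' = true then (1 : ZMod 2) else 0)) = 1))) ![true, false, false])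
    (hα12 : ∀ v : Fin 3 → Bool, ((bxor b₃ (fun t => decide ((∑ t', M t t' * (if v t' = true then (1 : ZMod 2) else 0)) = 1))) 1 && (bxor b₃ (fun t => decide ((∑ t', M t t' * (if v t' = true then (1 : ZMod 2) else 0)) = 1))) 2) = (v 1 && v 2)) :
    ∃ (κ' : (Fin (3 + m) → Bool) → Bool) (c' d' : Fin (3 + m) → Fin (3 + m) → Fin (3 + m) → ZMod 2),
      IsDegLeFun 3 κ' ∧
      (∀ p j k, c' p k j = c' p j k) ∧ (∀ p j k, c' j p k = c' p j k) ∧ (∀ p j, c' p j j = 0) ∧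
      (∀ φ j k, d' φ j k =
        if ((((κ' zeroVec ^^ κ' (bxor zeroVec (fun l => decide (l = k)))) ^^
                (κ' (bxor zeroVec (fun l => decide (l = j))) ^^ κ' (bxor (bxor zeroVec (fun l => decide (l = j))) (fun l => decide (l = k))))) ^^
              ((κ' (bxor zeroVec (fun l => decide (l = φ))) ^^ κ' (bxor (bxor zeroVec (fun l => decide (l = φ))) (fun l => decide (l = k)))) ^^
                (κ' (bxor (bxor zeroVec (fun l => decide (l = φ))) (fun l => decide (l = j))) ^^
                  κ' (bxor (bxor (bxor zeroVec (fun l => decide (l = φ))) (fun l => decide (l = j))) (fun l => decide (l = k))))))) = true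
        then 1 else 0) ∧
      (∀ p φ, (∑ j, ∑ k, (if j < k then c' p j k * d' φ j k else 0)) = if p = φ then 1 else 0) ∧
      (∀ y, (κ' y ^^ κ' (bxor y (fun l => decide (l = Fin.castAdd m (0 : Fin 3))))) =
        (y (Fin.castAdd m (1 : Fin 3)) && y (Fin.castAdd m (2 : Fin 3)))) ∧
      (∀ j k, d' (Fin.castAdd m (0 : Fin 3)) j k =
        if (j = Fin.castAdd m (1 : Fin 3) ∧ k = Fin.castAdd m (2 : Fin 3)) ∨ (j = Fin.castAdd m (2 : Fin 3) ∧ k = Fin.castAdd m (1 : Fin 3))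
        then 1 else 0) ∧
      (∀ (v : Fin 3 → Bool) (s : Fin m → Bool), κ' (Fin.append v s) =
        κ (Fin.append (bxor b₃ (fun t => decide ((∑ t', M t t' * (if v t' = true then (1 : ZMod 2) else 0)) = 1))) s)) := by
  obtain ⟨L, Li, hLLi, hLiL, hLapp, -⟩ := tpw_yblock_frame (m := m) M Mi hMMi hMiM
  obtain ⟨κ', c', d', hκap, -, -, hκ'3, -, hcs', hcc', hcd', hd'T, hpair'⟩ :=
    tpw_partner_transport κ hκ c d hcs hcc hcd hds hdd hd hpair L Li hLLi hLiL (Fin.append b₃ (zeroVec : Fin m → Bool))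
  have hcell : ∀ (v : Fin 3 → Bool) (s : Fin m → Bool), κ' (Fin.append v s) =
      κ (Fin.append (bxor b₃ (fun t => decide ((∑ t', M t t' * (if v t' = true then (1 : ZMod 2) else 0)) = 1))) s) := by
    intro v s
    rw [hκap, hLapp v s, tcc_append_bxor, zeroVec_bxor]
  have hD0' : ∀ y, (κ' y ^^ κ' (bxor y (fun l => decide (l = Fin.castAdd m (0 : Fin 3))))) =
      (y (Fin.castAdd m (1 : Fin 3)) && y (Fin.castAdd m (2 : Fin 3))) := by
    intro y
    obtain ⟨v, s, rfl⟩ : ∃ (v : Fin 3 → Bool) (s : Fin m → Bool), y = Fin.append v s := ⟨_, _, tpw_append_split y⟩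
    have h2 : bxor (Fin.append v s) (fun l => decide (l = Fin.castAdd m (0 : Fin 3))) = Fin.append (bxor v ![true, false, false]) s := by
      rw [tpw_e0_append, tcc_append_bxor, bxor_zeroVec]
    have h5 : ∀ w : Fin 3 → Bool, Fin.append (bxor w ![true, false, false]) s =
        bxor (Fin.append w s) (fun l => decide (l = Fin.castAdd m (0 : Fin 3))) := fun w => by
      rw [tpw_e0_append, tcc_append_bxor, bxor_zeroVec]
    rw [Fin.append_left, Fin.append_left, h2, hcell, hcell, hα0, h5, hD0, Fin.append_left, Fin.append_left, hα12]
  refine ⟨κ', c', d', hκ'3, hcs', hcc', hcd', hd'T, hpair', hD0', tpw_F1_of_frame_identity κ' d' hd'T hD0', hcell⟩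

/-- **WLOG the light cell is `C₀₀`.**  For a free cell `(i,j)` (`(i ∧ j) = 0`) of an adapted-frame package there is an adapted-frame package
`κ', c', d'` (cubic, symmetric partner, cubic form, `(PAIR)`, frame identity, `hF1`) whose cell `C₀₀` is the old `C_{ij}`, whose `C_{ij}` is
the old `C₀₀`, and whose remaining free cell is unchanged — via the `S₃`-symmetry maps `(y₁,y₂) ↦ (y₁⊕y₂⊕1, y₂)`, `(y₁, y₁⊕y₂⊕1)` (or the
identity). [this work] -/
theorem tpw_R2_wlog_base (κ : (Fin (3 + m) → Bool) → Bool) (hκ : IsDegLeFun 3 κ)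
    (c d : Fin (3 + m) → Fin (3 + m) → Fin (3 + m) → ZMod 2)
    (hcs : ∀ p j k, c p k j = c p j k) (hcc : ∀ p j k, c j p k = c p j k) (hcd : ∀ p j, c p j j = 0)
    (hds : ∀ φ j k, d φ k j = d φ j k) (hdd : ∀ φ j, d φ j j = 0)
    (hd : ∀ φ j k, d φ j k =
      if ((((κ zeroVec ^^ κ (bxor zeroVec (fun l => decide (l = k)))) ^^
            (κ (bxor zeroVec (fun l => decide (l = j))) ^^ κ (bxor (bxor zeroVec (fun l => decide (l = j))) (fun l => decide (l = k))))) ^^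
          ((κ (bxor zeroVec (fun l => decide (l = φ))) ^^ κ (bxor (bxor zeroVec (fun l => decide (l = φ))) (fun l => decide (l = k)))) ^^
            (κ (bxor (bxor zeroVec (fun l => decide (l = φ))) (fun l => decide (l = j))) ^^
              κ (bxor (bxor (bxor zeroVec (fun l => decide (l = φ))) (fun l => decide (l = j))) (fun l => decide (l = k))))))) = true
      then 1 else 0)
    (hpair : ∀ p φ, (∑ j, ∑ k, (if j < k then c p j k * d φ j k else 0)) = if p = φ then 1 else 0)
    (hD0 : ∀ y, (κ y ^^ κ (bxor y (fun l => decide (l = Fin.castAdd m (0 : Fin 3))))) =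
      (y (Fin.castAdd m (1 : Fin 3)) && y (Fin.castAdd m (2 : Fin 3))))
    (i j : Bool) (hij : (i && j) = false) :
    ∃ (κ' : (Fin (3 + m) → Bool) → Bool) (c' d' : Fin (3 + m) → Fin (3 + m) → Fin (3 + m) → ZMod 2),
      IsDegLeFun 3 κ' ∧
      (∀ p j k, c' p k j = c' p j k) ∧ (∀ p j k, c' j p k = c' p j k) ∧ (∀ p j, c' p j j = 0) ∧
      (∀ φ j k, d' φ j k =
        if ((((κ' zeroVec ^^ κ' (bxor zeroVec (fun l => decide (l = k)))) ^^
                (κ' (bxor zeroVec (fun l => decide (l = j))) ^^ κ' (bxor (bxor zeroVec (fun l => decide (l = j))) (fun l => decide (l = k))))) ^^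
              ((κ' (bxor zeroVec (fun l => decide (l = φ))) ^^ κ' (bxor (bxor zeroVec (fun l => decide (l = φ))) (fun l => decide (l = k)))) ^^
                (κ' (bxor (bxor zeroVec (fun l => decide (l = φ))) (fun l => decide (l = j))) ^^
                  κ' (bxor (bxor (bxor zeroVec (fun l => decide (l = φ))) (fun l => decide (l = j))) (fun l => decide (l = k))))))) = true
        then 1 else 0) ∧
      (∀ p φ, (∑ j, ∑ k, (if j < k then c' p j k * d' φ j k else 0)) = if p = φ then 1 else 0) ∧
      (∀ y, (κ' y ^^ κ' (bxor y (fun l => decide (l = Fin.castAdd m (0 : Fin 3))))) =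
        (y (Fin.castAdd m (1 : Fin 3)) && y (Fin.castAdd m (2 : Fin 3)))) ∧
      (∀ j k, d' (Fin.castAdd m (0 : Fin 3)) j k =
        if (j = Fin.castAdd m (1 : Fin 3) ∧ k = Fin.castAdd m (2 : Fin 3)) ∨ (j = Fin.castAdd m (2 : Fin 3) ∧ k = Fin.castAdd m (1 : Fin 3))
        then 1 else 0) ∧
      (∀ s : Fin m → Bool, κ' (Fin.append ![false, false, false] s) = κ (Fin.append ![false, i, j] s)) ∧
      (∀ s : Fin m → Bool, κ' (Fin.append ![false, i, j] s) = κ (Fin.append ![false, false, false] s)) ∧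
      (∀ i' j' : Bool, (i' && j') = false → ¬ (i' = i ∧ j' = j) → ¬ (i' = false ∧ j' = false) →
        ∀ s : Fin m → Bool, κ' (Fin.append ![false, i', j'] s) = κ (Fin.append ![false, i', j'] s)) := by
  have hdc : ∀ φ j k, d j φ k = d φ j k := fun φ j k => by
    rw [hd j φ k, hd φ j k, tcf_third_swap12 κ (fun l => decide (l = j)) (fun l => decide (l = φ)) (fun l => decide (l = k)) zeroVec]
  cases i <;> cases j
  · -- `(i,j) = (0,0)`: nothing to do
    refine ⟨κ, c, d, hκ, hcs, hcc, hcd, hd, hpair, hD0, tpw_F1_of_frame_identity κ d hd hD0, fun s => rfl, fun s => rfl,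
      fun i' j' _ _ _ s => rfl⟩
  · -- `(i,j) = (0,1)`: the map `(y₁, y₂) ↦ (y₁, y₁ ⊕ y₂ ⊕ 1)`
    obtain ⟨κ', c', d', hκ'3, hcs', hcc', hcd', hd'T, hpair', hD0', hF1', hcell⟩ :=
      tpw_R2_yframe_transport κ hκ c d hcs hcc hcd hds hdd hd hpair hD0
        (fun t t' => if t = t' then 1 else if (t = 2 ∧ t' = 1) then 1 else 0)
        (fun t t' => if t = t' then 1 else if (t = 2 ∧ t' = 1) then 1 else 0)
        (by decide) (by decide) ![false, false, true] (by decide) (by decide)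
    refine ⟨κ', c', d', hκ'3, hcs', hcc', hcd', hd'T, hpair', hD0', hF1', fun s => ?_, fun s => ?_, fun i' j' h1 h2 h3 s => ?_⟩
    · rw [hcell]; congr 2; decide
    · rw [hcell]; congr 2; decide
    · cases i' <;> cases j'
      · exact absurd ⟨rfl, rfl⟩ h3
      · exact absurd ⟨rfl, rfl⟩ h2
      · rw [hcell]; congr 2; decide
      · exact absurd h1 (by decide)
  · -- `(i,j) = (1,0)`: the map `(y₁, y₂) ↦ (y₁ ⊕ y₂ ⊕ 1, y₂)`
    obtain ⟨κ', c', d', hκ'3, hcs', hcc', hcd', hd'T, hpair', hD0', hF1', hcell⟩ :=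
      tpw_R2_yframe_transport κ hκ c d hcs hcc hcd hds hdd hd hpair hD0
        (fun t t' => if t = t' then 1 else if (t = 1 ∧ t' = 2) then 1 else 0)
        (fun t t' => if t = t' then 1 else if (t = 1 ∧ t' = 2) then 1 else 0)
        (by decide) (by decide) ![false, true, false] (by decide) (by decide)
    refine ⟨κ', c', d', hκ'3, hcs', hcc', hcd', hd'T, hpair', hD0', hF1', fun s => ?_, fun s => ?_, fun i' j' h1 h2 h3 s => ?_⟩
    · rw [hcell]; congr 2; decide
    · rw [hcell]; congr 2; decide
    · cases i' <;> cases j'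
      · exact absurd ⟨rfl, rfl⟩ h3
      · rw [hcell]; congr 2; decide
      · exact absurd ⟨rfl, rfl⟩ h2
      · exact absurd h1 (by decide)
  · exact absurd hij (by decide)

end Summit.QuantumAdvantage.QuantumAdvantage.Theorems.CubicForrelation.NearExactIsExact
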